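import Summits.BirchSwinnertonDyer.BirchSwinnertonDyer.Theorems.Rank2ObservatoryRank3Witness
import Summits.BirchSwinnertonDyer.BirchSwinnertonDyer.Theorems.Rank2ObservatoryKernelAnnihilator2
import HarnessLib

/-!
# BirchSwinnertonDyer — rank ≥ 2 observatory: rank-3 kernel certificate with the sharpened torsion exponent

HONEST FRAMING: per-curve certified theorems and census instruments; no claim on BSD in rank ≥ 2.

The rank-3 kernel certificates (`Rank2ObservatoryRank3Witness.lean`,
`three_le_mordellWeilRank_of_kernelCert`) kill `E(ℚ)_tors` by `t = 2^u · m` read off two kernel point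
counts `#Ẽ(𝔽_ℓ)`. Point counts are isogeny invariants: a curve with `E(ℚ)_tors ≅ ℤ/2` whose isogeny
class contains a curve with full rational `2`-torsion or a rational `4`-torsion point has
`4 ∣ #Ẽ(𝔽_ℓ)` at every good odd prime, forcing `u = 2`, for which no coset test is implemented
(80 of the 9 487 rank-3 census rows). `Rank2ObservatoryKernelAnnihilator2.lean` (cert-1) supplies the
missing kernel input — ONE good odd prime `ℓ₀` with `noOrder4 V ℓ₀` (no point of order `4` in
`Ẽ(𝔽_ℓ₀)`, hence none in `E(ℚ)` by injectivity of reduction on prime-to-`ℓ₀` torsion, AEC VII.3.1(b)),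
after which `2 · m` kills `E(ℚ)_tors` (`two_mul_nsmul_eq_zero_of_noOrder4`). This file is the rank-3
certificate with that input: `three_le_mordellWeilRank_of_kernelCertT` — as
`three_le_mordellWeilRank_of_kernelCert` with `t = 2^e · m` from the counts, `ℓ₀` with `noOrder4`, and the
seven coset tests at exponent `u = 1` (`cosetFreeB V q 1` = `xCosetFree`: `(x, y) ∉ 2Ẽ + Ẽ[2]`).
Sorry-free; no definitions. References: Silverman AEC (2009) III.2.3, VII.3.1(b), VIII.6.7; Cremona
(1997) §3.5.
-/

-- single-conjunct summit: `Summit.BirchSwinnertonDyer.BirchSwinnertonDyer.…` repeats the name by design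
set_option linter.dupNamespace false

namespace Summit.BirchSwinnertonDyer.BirchSwinnertonDyer.Rank2Observatory

open WeierstrassCurve Literature.NumberTheory.EllipticCurves

/-! ### The sharpened annihilator and the certificate variant -/

section Assembly

variable (V : WeierstrassCurve ℤ)

/-- **`2m` kills `E(ℚ)_tors`** (integer-scalar form of cert-1's `two_mul_nsmul_eq_zero_of_noOrder4`):
`t = 2^e · m` kills the torsion (`annihilatorCheck`, two kernel point counts) and one good odd prime `ℓ₀`
has `noOrder4 V ℓ₀`. [cite: SilvermanAEC2009, Prop. VII.3.1(b)] -/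
theorem torsion_zsmul_eq_zero_of_noOrder4 {S : List (ℕ × ℕ)} {t e m : ℕ} (hte : t = 2 ^ e * m)
    (hS : ∀ ℓN ∈ S, ℓN.1.Prime ∧
      ∀ (x : (V.map (Int.castRingHom ℚ)).toAffine.Point) (n : ℕ), ¬ ℓN.1 ∣ n → n • x = 0 →
        ℓN.2 • x = 0)
    (ht : annihilatorCheck S t = true) (ℓ₀ : ℕ) [Fact ℓ₀.Prime] (hℓ₀ : ¬ (ℓ₀ : ℤ) ∣ V.Δ)
    (hodd : ℓ₀ ≠ 2) (hB : noOrder4 V ℓ₀ = true)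
    (x : (V.map (Int.castRingHom ℚ)).toAffine.Point) (hx : IsOfFinAddOrder x) :
    ((2 : ℤ) ^ 1 * (m : ℤ)) • x = 0 := by
  have h := two_mul_nsmul_eq_zero_of_noOrder4 V ℓ₀ hℓ₀ hodd hB hS ht hte x hx
  rw [pow_one, ← natCast_zsmul] at *
  exact_mod_cast h

/-- **Rank-3 kernel certificate with the sharpened torsion input**: as
`three_le_mordellWeilRank_of_kernelCert` but the annihilator certified from the counts is `t = 2^e·m`
(`m` odd, any `e`) and ONE good odd prime `ℓ₀` with `noOrder4 V ℓ₀` lowers the `2`-exponent to `u = 1`,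
so the seven coset tests are `cosetFreeB V q 1` (`(x, y) ∉ 2Ẽ + Ẽ[2]`). [cite: CremonaAlgorithms1997, §3.5]
[cite: SilvermanAEC2009, Thm. VIII.6.7] -/
theorem three_le_mordellWeilRank_of_kernelCertT {X₁ Y₁ X₂ Y₂ X₃ Y₃ : ℤ}
    (h₁ : Y₁ ^ 2 + V.a₁ * X₁ * Y₁ + V.a₃ * Y₁ = X₁ ^ 3 + V.a₂ * X₁ ^ 2 + V.a₄ * X₁ + V.a₆)
    (h₂ : Y₂ ^ 2 + V.a₁ * X₂ * Y₂ + V.a₃ * Y₂ = X₂ ^ 3 + V.a₂ * X₂ ^ 2 + V.a₄ * X₂ + V.a₆)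
    (h₃ : Y₃ ^ 2 + V.a₁ * X₃ * Y₃ + V.a₃ * Y₃ = X₃ ^ 3 + V.a₂ * X₃ ^ 2 + V.a₄ * X₃ + V.a₆)
    {S : List (ℕ × ℕ)} {t e m : ℕ} (hm : m % 2 = 1) (hte : t = 2 ^ e * m)
    (hS : ∀ ℓN ∈ S, ℓN.1.Prime ∧
      ∀ (x : (V.map (Int.castRingHom ℚ)).toAffine.Point) (n : ℕ), ¬ ℓN.1 ∣ n → n • x = 0 →
        ℓN.2 • x = 0)
    (ht : annihilatorCheck S t = true)
    (ℓ₀ : ℕ) [Fact ℓ₀.Prime] (hℓ₀ : ¬ (ℓ₀ : ℤ) ∣ V.Δ) (hodd : ℓ₀ ≠ 2) (hB : noOrder4 V ℓ₀ = true)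
    (q₁ q₂ q₃ q₁₂ q₁₃ q₂₃ q₁₂₃ : ℕ) [Fact q₁.Prime] [Fact q₂.Prime] [Fact q₃.Prime]
    [Fact q₁₂.Prime] [Fact q₁₃.Prime] [Fact q₂₃.Prime] [Fact q₁₂₃.Prime]
    (hq₁ : ¬ (q₁ : ℤ) ∣ V.Δ) (hq₂ : ¬ (q₂ : ℤ) ∣ V.Δ) (hq₃ : ¬ (q₃ : ℤ) ∣ V.Δ)
    (hq₁₂ : ¬ (q₁₂ : ℤ) ∣ V.Δ) (hq₁₃ : ¬ (q₁₃ : ℤ) ∣ V.Δ) (hq₂₃ : ¬ (q₂₃ : ℤ) ∣ V.Δ)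
    (hq₁₂₃ : ¬ (q₁₂₃ : ℤ) ∣ V.Δ)
    (hw₁ : cosetFreeB V q₁ 1 (X₁ : ZMod q₁) (Y₁ : ZMod q₁) = true)
    (hw₂ : cosetFreeB V q₂ 1 (X₂ : ZMod q₂) (Y₂ : ZMod q₂) = true)
    (hw₃ : cosetFreeB V q₃ 1 (X₃ : ZMod q₃) (Y₃ : ZMod q₃) = true)
    {X₁₂ Y₁₂ : ℤ}
    (hc₁₂ : zmodChord V q₁₂ (X₁ : ZMod q₁₂) (Y₁ : ZMod q₁₂) (X₂ : ZMod q₁₂) (Y₂ : ZMod q₁₂)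
      (X₁₂ : ZMod q₁₂) (Y₁₂ : ZMod q₁₂) = true)
    (hw₁₂ : cosetFreeB V q₁₂ 1 (X₁₂ : ZMod q₁₂) (Y₁₂ : ZMod q₁₂) = true)
    {X₁₃ Y₁₃ : ℤ}
    (hc₁₃ : zmodChord V q₁₃ (X₁ : ZMod q₁₃) (Y₁ : ZMod q₁₃) (X₃ : ZMod q₁₃) (Y₃ : ZMod q₁₃)
      (X₁₃ : ZMod q₁₃) (Y₁₃ : ZMod q₁₃) = true)
    (hw₁₃ : cosetFreeB V q₁₃ 1 (X₁₃ : ZMod q₁₃) (Y₁₃ : ZMod q₁₃) = true)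
    {X₂₃ Y₂₃ : ℤ}
    (hc₂₃ : zmodChord V q₂₃ (X₂ : ZMod q₂₃) (Y₂ : ZMod q₂₃) (X₃ : ZMod q₂₃) (Y₃ : ZMod q₂₃)
      (X₂₃ : ZMod q₂₃) (Y₂₃ : ZMod q₂₃) = true)
    (hw₂₃ : cosetFreeB V q₂₃ 1 (X₂₃ : ZMod q₂₃) (Y₂₃ : ZMod q₂₃) = true)
    {X₀ Y₀ X₁₂₃ Y₁₂₃ : ℤ}
    (hc₀ : zmodChord V q₁₂₃ (X₁ : ZMod q₁₂₃) (Y₁ : ZMod q₁₂₃) (X₂ : ZMod q₁₂₃) (Y₂ : ZMod q₁₂₃)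
      (X₀ : ZMod q₁₂₃) (Y₀ : ZMod q₁₂₃) = true)
    (hc₁₂₃ : zmodChord V q₁₂₃ (X₀ : ZMod q₁₂₃) (Y₀ : ZMod q₁₂₃) (X₃ : ZMod q₁₂₃) (Y₃ : ZMod q₁₂₃)
      (X₁₂₃ : ZMod q₁₂₃) (Y₁₂₃ : ZMod q₁₂₃) = true)
    (hw₁₂₃ : cosetFreeB V q₁₂₃ 1 (X₁₂₃ : ZMod q₁₂₃) (Y₁₂₃ : ZMod q₁₂₃) = true) :
    3 ≤ (V.map (Int.castRingHom ℚ)).mordellWeilRank := by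
  classical
  have hΔ : V.Δ ≠ 0 := Δ_ne_zero_of_not_dvd V hq₁
  haveI := isElliptic_rat V hΔ
  have hm' : Odd (m : ℤ) := by exact_mod_cast Nat.odd_iff.mpr hm
  have htors : ∀ x : (V.map (Int.castRingHom ℚ)).toAffine.Point, IsOfFinAddOrder x →
      ((2 : ℤ) ^ 1 * (m : ℤ)) • x = 0 :=
    fun x hx => torsion_zsmul_eq_zero_of_noOrder4 V hte hS ht ℓ₀ hℓ₀ hodd hB x hx
  have e₁ : V.toAffine.Equation X₁ Y₁ := (Affine.equation_iff X₁ Y₁).mpr h₁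
  have e₂ : V.toAffine.Equation X₂ Y₂ := (Affine.equation_iff X₂ Y₂).mpr h₂
  have e₃ : V.toAffine.Equation X₃ Y₃ := (Affine.equation_iff X₃ Y₃).mpr h₃
  refine three_le_mordellWeilRank_of_cosetWitness (V.map (Int.castRingHom ℚ)) hm' htors
    (P₁ := .some _ _ (nonsingular_rat_of_eq V hΔ h₁))
    (P₂ := .some _ _ (nonsingular_rat_of_eq V hΔ h₂))
    (P₃ := .some _ _ (nonsingular_rat_of_eq V hΔ h₃)) ?_ ?_ ?_ ?_ ?_ ?_ ?_
  · refine not_mem_twoCoset_of_map_not_mem (reduceMod V q₁ hq₁) ?_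
    rw [reduceMod_some V q₁ hq₁ e₁]
    exact not_mem_twoCoset_of_cosetFreeB V q₁ hw₁ _
  · refine not_mem_twoCoset_of_map_not_mem (reduceMod V q₂ hq₂) ?_
    rw [reduceMod_some V q₂ hq₂ e₂]
    exact not_mem_twoCoset_of_cosetFreeB V q₂ hw₂ _
  · refine not_mem_twoCoset_of_map_not_mem (reduceMod V q₃ hq₃) ?_
    rw [reduceMod_some V q₃ hq₃ e₃]
    exact not_mem_twoCoset_of_cosetFreeB V q₃ hw₃ _
  · refine not_mem_twoCoset_of_map_not_mem (reduceMod V q₁₂ hq₁₂) ?_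
    rw [map_add, reduceMod_some V q₁₂ hq₁₂ e₁, reduceMod_some V q₁₂ hq₁₂ e₂]
    obtain ⟨h', e⟩ := exists_some_add_some_of_zmodChord V q₁₂ _ _ hc₁₂
    rw [e]
    exact not_mem_twoCoset_of_cosetFreeB V q₁₂ hw₁₂ _
  · refine not_mem_twoCoset_of_map_not_mem (reduceMod V q₁₃ hq₁₃) ?_
    rw [map_add, reduceMod_some V q₁₃ hq₁₃ e₁, reduceMod_some V q₁₃ hq₁₃ e₃]
    obtain ⟨h', e⟩ := exists_some_add_some_of_zmodChord V q₁₃ _ _ hc₁₃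
    rw [e]
    exact not_mem_twoCoset_of_cosetFreeB V q₁₃ hw₁₃ _
  · refine not_mem_twoCoset_of_map_not_mem (reduceMod V q₂₃ hq₂₃) ?_
    rw [map_add, reduceMod_some V q₂₃ hq₂₃ e₂, reduceMod_some V q₂₃ hq₂₃ e₃]
    obtain ⟨h', e⟩ := exists_some_add_some_of_zmodChord V q₂₃ _ _ hc₂₃
    rw [e]
    exact not_mem_twoCoset_of_cosetFreeB V q₂₃ hw₂₃ _
  · refine not_mem_twoCoset_of_map_not_mem (reduceMod V q₁₂₃ hq₁₂₃) ?_
    rw [map_add, map_add, reduceMod_some V q₁₂₃ hq₁₂₃ e₁, reduceMod_some V q₁₂₃ hq₁₂₃ e₂,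
      reduceMod_some V q₁₂₃ hq₁₂₃ e₃]
    obtain ⟨h', e⟩ := exists_some_add_some_of_zmodChord V q₁₂₃ _ _ hc₀
    rw [e]
    obtain ⟨h'', e'⟩ := exists_some_add_some_of_zmodChord V q₁₂₃ _ _ hc₁₂₃
    rw [e']
    exact not_mem_twoCoset_of_cosetFreeB V q₁₂₃ hw₁₂₃ _

end Assembly

end Summit.BirchSwinnertonDyer.BirchSwinnertonDyer.Rank2Observatory
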